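import Summits.AtomisticToContinuum.HydrodynamicLimit.Theorems.MourreKoopmanChargesStressStrongMixingGibbsMoments
import HarnessLib

/-!
# `StressStrongMixing` · line `birth`, stub F3static `stub_staticClustering`, part 2:
# fourth moments of local linear statistics under a hard-sphere Gibbs state

Support file for the crux item stmt-AtomisticToContinuum-9584 (`StressStrongMixing`, route `MourreKoopmanCharges` of
`AtomisticToContinuum/HydrodynamicLimit`), line `birth`, registered stub `stub_staticClustering` (F3static).

The fourth-moment analogue of `…GibbsMoments.lean` (which proved square integrability): for a linear statistic
`A_f = Σ_{p ∈ ω} f(p)` of a measurable one-particle function `f` supported over a bounded window `Λ` with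
`|f(q, v)| ≤ C (1 + ‖v‖)ⁿ`,

* on a superposition of `k` thrown points, Cauchy–Schwarz twice gives `A_f⁴ ≤ C⁴ k³ Σᵢ (1 + ‖vᵢ‖)^{4n}`
  (`pow_four_sum_le`, `ofReal_linStat_superposeIn_pow_four_le`);
* under the `k`-particle a-priori law one coordinate costs `≤ Rᵏ`, `R = m(univ) + ∫ (1 + ‖v‖)^{4n} dm < ∞`, so the
  specification bound `∫ A_f⁴ dγ_Λ(·|Y) ≤ C⁴ Σₖ (zᵏ/k!) k⁴ Rᵏ < ∞` holds UNIFORMLY in the boundary condition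
  (`lintegral_pow_four_linStat_gibbsSpecMeasure_le`, `tsum_ofReal_pow_div_factorial_mul_pow_four_lt_top`);
* the DLR equation for functions transports it to the Gibbs state: `∫ A_f⁴ dμ < ∞`, in particular the six generators
  (five cell charges, cell shear stress) have finite fourth moments under every hard-sphere Gibbs state
  (`integrable_pow_four_cellObs_of_isHardSphereGibbs`, `integrable_pow_four_of_mem_generators`).

This is the truncation input of the static clustering estimate: `E[(a - clamp_K a)²] ≤ E[a⁴]/K²`.

References: D. Ruelle, *Statistical Mechanics* (1969), §4.2 (all local moments of a grand-canonical Gibbs state with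
Maxwellian momenta are finite); R. Alexander, Comm. Math. Phys. 49 (1976), §2.1.
-/

noncomputable section

open MeasureTheory ProbabilityTheory Filter Topology
open scoped ENNReal

namespace Summit.AtomisticToContinuum.HydrodynamicLimit.Theorems.MourreKoopmanChargesStressStrongMixing

open Literature.MathematicalPhysics.KineticTheory Literature.Analysis.FluidPDE
open Literature.Analysis.FunctionSpaces (PointConfig)
open Summit.AtomisticToContinuum.HydrodynamicLimit.Theorems.KiferCompactification (gibbsWeightMeasure gibbsSpecMeasure
  lintegral_eq_lintegral_gibbsSpecMeasure lintegral_gibbsWeightMeasure lintegral_gibbsSpecMeasure one_le_gibbsWeight_univ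
  sigmaFinite_maxwellPhaseMeasure)

/-! ### The fourth power of a linear statistic of a superposition -/

section Superposition

variable {Λ : Set V3}

/-- **Cauchy–Schwarz twice**: `(Σᵢ gᵢ)⁴ ≤ k³ Σᵢ gᵢ⁴` over `Fin k`. [folklore] -/
theorem pow_four_sum_le {k : ℕ} (g : Fin k → ℝ) : (∑ i, g i) ^ 4 ≤ (k : ℝ) ^ 3 * ∑ i, g i ^ 4 := by
  have h1 : (∑ i, g i) ^ 2 ≤ k * ∑ i, g i ^ 2 := by
    have h := sq_sum_le_card_mul_sum_sq (s := Finset.univ) (f := g)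
    rwa [Finset.card_univ, Fintype.card_fin] at h
  have h2 : (∑ i, g i ^ 2) ^ 2 ≤ k * ∑ i, (g i ^ 2) ^ 2 := by
    have h := sq_sum_le_card_mul_sum_sq (s := Finset.univ) (f := fun i => g i ^ 2)
    rwa [Finset.card_univ, Fintype.card_fin] at h
  have h0 : 0 ≤ ∑ i, g i ^ 2 := Finset.sum_nonneg fun i _ => sq_nonneg (g i)
  calc (∑ i, g i) ^ 4 = ((∑ i, g i) ^ 2) ^ 2 := by ring
    _ ≤ ((k : ℝ) * ∑ i, g i ^ 2) ^ 2 := pow_le_pow_left₀ (sq_nonneg _) h1 2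
    _ = (k : ℝ) ^ 2 * (∑ i, g i ^ 2) ^ 2 := by ring
    _ ≤ (k : ℝ) ^ 2 * (k * ∑ i, (g i ^ 2) ^ 2) := mul_le_mul_of_nonneg_left h2 (by positivity)
    _ = (k : ℝ) ^ 3 * ∑ i, g i ^ 4 := by
        rw [show (k : ℝ) ^ 3 = (k : ℝ) ^ 2 * k by ring, mul_assoc]
        congr 2
        exact Finset.sum_congr rfl fun i _ => by ring

/-- **The fourth power on the thrown points**, in `ℝ≥0∞`: if `|f(q, v)| ≤ C (1 + ‖v‖)ⁿ` and `f` vanishes off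
`Λ × ℝ³`, then `A_f(superposeIn Λ x Y)⁴ ≤ C⁴ · k³ · Σᵢ (1 + ‖vᵢ‖)^{4n}`. [folklore] -/
theorem ofReal_linStat_superposeIn_pow_four_le {f : V3 × V3 → ℝ} {C : ℝ} {n : ℕ}
    (hf : ∀ p : V3 × V3, |f p| ≤ C * (1 + ‖p.2‖) ^ n) (hfΛ : ∀ p : V3 × V3, p.1 ∉ Λ → f p = 0)
    {k : ℕ} (x : Fin k → V3 × V3) (Y : MarkedConfig) :
    ENNReal.ofReal (linStat f (superposeIn Λ x Y) ^ 4) ≤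
      ENNReal.ofReal (C ^ 4) * ((k : ℝ≥0∞) ^ 3 * ∑ i, ENNReal.ofReal ((1 + ‖(x i).2‖) ^ (4 * n))) := by
  have h1 : |linStat f (superposeIn Λ x Y)| ≤ ∑ i, C * (1 + ‖(x i).2‖) ^ n :=
    abs_linStat_superposeIn_le (g := fun v => C * (1 + ‖v‖) ^ n) hf hfΛ x Y
  have h2 : linStat f (superposeIn Λ x Y) ^ 4 ≤ (∑ i, C * (1 + ‖(x i).2‖) ^ n) ^ 4 := by
    rw [← abs_of_nonneg (Even.pow_nonneg (by decide : Even 4) (linStat f (superposeIn Λ x Y))), abs_pow]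
    exact pow_le_pow_left₀ (abs_nonneg _) h1 4
  have h3 : (∑ i, C * (1 + ‖(x i).2‖) ^ n) ^ 4 ≤ C ^ 4 * ((k : ℝ) ^ 3 * ∑ i, (1 + ‖(x i).2‖) ^ (4 * n)) := by
    rw [← Finset.mul_sum, mul_pow]
    refine mul_le_mul_of_nonneg_left ?_ (Even.pow_nonneg (by decide : Even 4) C)
    calc (∑ i, (1 + ‖(x i).2‖) ^ n) ^ 4 ≤ (k : ℝ) ^ 3 * ∑ i, ((1 + ‖(x i).2‖) ^ n) ^ 4 := pow_four_sum_le _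
      _ = (k : ℝ) ^ 3 * ∑ i, (1 + ‖(x i).2‖) ^ (4 * n) := by
          congr 1
          refine Finset.sum_congr rfl fun i _ => ?_
          rw [← pow_mul, mul_comm]
  calc ENNReal.ofReal (linStat f (superposeIn Λ x Y) ^ 4)
      ≤ ENNReal.ofReal (C ^ 4 * ((k : ℝ) ^ 3 * ∑ i, (1 + ‖(x i).2‖) ^ (4 * n))) :=
        ENNReal.ofReal_le_ofReal (h2.trans h3)
    _ = ENNReal.ofReal (C ^ 4) * ((k : ℝ≥0∞) ^ 3 * ∑ i, ENNReal.ofReal ((1 + ‖(x i).2‖) ^ (4 * n))) := by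
        rw [ENNReal.ofReal_mul (Even.pow_nonneg (by decide : Even 4) C), ENNReal.ofReal_mul (by positivity),
          ENNReal.ofReal_pow (Nat.cast_nonneg k), ENNReal.ofReal_natCast,
          ENNReal.ofReal_sum_of_nonneg fun i _ => by positivity]

/-- **The `k`-particle term**: for `|f(q, v)| ≤ C (1 + ‖v‖)ⁿ` vanishing off `Λ × ℝ³` and any event `S` of thrown points,
`∫_S A_f(superposeIn Λ x Y)⁴ dm^{⊗k}(x) ≤ C⁴ · k³ · (k · Rᵏ)`, `R = m(univ) + ∫ (1 + ‖v‖)^{4n} dm`. [folklore] -/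
theorem setLIntegral_pi_pow_four_linStat_superposeIn_le {f : V3 × V3 → ℝ} {C : ℝ} {n : ℕ}
    (hf : ∀ p : V3 × V3, |f p| ≤ C * (1 + ‖p.2‖) ^ n) (hfΛ : ∀ p : V3 × V3, p.1 ∉ Λ → f p = 0)
    (m : Measure (V3 × V3)) [SigmaFinite m] (k : ℕ) (Y : MarkedConfig) (S : Set (Fin k → V3 × V3)) :
    ∫⁻ x in S, ENNReal.ofReal (linStat f (superposeIn Λ x Y) ^ 4) ∂(Measure.pi fun _ : Fin k => m) ≤
      ENNReal.ofReal (C ^ 4) * ((k : ℝ≥0∞) ^ 3 * ((k : ℝ≥0∞) *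
        (m Set.univ + ∫⁻ p, ENNReal.ofReal ((1 + ‖p.2‖) ^ (4 * n)) ∂m) ^ k)) := by
  -- adapted from `setLIntegral_pi_sq_linStat_superposeIn_le` (…StressStrongMixingGibbsMoments.lean)
  set G : V3 × V3 → ℝ≥0∞ := fun p => ENNReal.ofReal ((1 + ‖p.2‖) ^ (4 * n)) with hGdef
  have hG : Measurable G := measurable_ofReal_one_add_norm_snd_pow (4 * n)
  set P : Measure (Fin k → V3 × V3) := Measure.pi fun _ : Fin k => m with hP
  calc ∫⁻ x in S, ENNReal.ofReal (linStat f (superposeIn Λ x Y) ^ 4) ∂P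
      ≤ ∫⁻ x, ENNReal.ofReal (linStat f (superposeIn Λ x Y) ^ 4) ∂P := setLIntegral_le_lintegral S _
    _ ≤ ∫⁻ x, ENNReal.ofReal (C ^ 4) * ((k : ℝ≥0∞) ^ 3 * ∑ i, G (x i)) ∂P :=
        lintegral_mono fun x => ofReal_linStat_superposeIn_pow_four_le hf hfΛ x Y
    _ = ENNReal.ofReal (C ^ 4) * ((k : ℝ≥0∞) ^ 3 * ∑ i, ∫⁻ x, G (x i) ∂P) := by
        rw [lintegral_const_mul' _ _ ENNReal.ofReal_ne_top,
          lintegral_const_mul' _ _ (ENNReal.pow_ne_top (ENNReal.natCast_ne_top k)),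
          lintegral_finsetSum Finset.univ (f := fun (i : Fin k) (x : Fin k → V3 × V3) => G (x i))
            fun i _ => hG.comp (measurable_pi_apply i)]
    _ ≤ ENNReal.ofReal (C ^ 4) * ((k : ℝ≥0∞) ^ 3 * ∑ _i : Fin k, (m Set.univ + ∫⁻ p, G p ∂m) ^ k) := by
        gcongr with i _
        exact lintegral_comp_eval_pi_le m hG i
    _ = _ := by rw [Finset.sum_const, Finset.card_univ, Fintype.card_fin, nsmul_eq_mul]

end Superposition

/-! ### The specification bound, the Gibbs bound, fourth moments of the generators -/

section Gibbs

variable {Λ : Set V3}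

/-- `Σₖ (zᵏ/k!) k⁴ Rᵏ < ∞` for `z ≥ 0` and `R < ∞` (`k⁴ ≤ 16ᵏ`, so the sum is at most `e^{16zR}`). [folklore] -/
theorem tsum_ofReal_pow_div_factorial_mul_pow_four_lt_top {z : ℝ} (hz : 0 ≤ z) {R : ℝ≥0∞} (hR : R ≠ ∞) :
    ∑' k : ℕ, ENNReal.ofReal (z ^ k / (Nat.factorial k)) * ((k : ℝ≥0∞) ^ 3 * ((k : ℝ≥0∞) * R ^ k)) < ∞ := by
  -- adapted from `tsum_ofReal_pow_div_factorial_mul_sq_mul_pow_lt_top` (…StressStrongMixingGibbsMoments.lean)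
  set r : ℝ := R.toReal with hr
  have hr0 : 0 ≤ r := ENNReal.toReal_nonneg
  have hRr : R = ENNReal.ofReal r := (ENNReal.ofReal_toReal hR).symm
  have hle : ∀ k : ℕ, ENNReal.ofReal (z ^ k / (Nat.factorial k)) * ((k : ℝ≥0∞) ^ 3 * ((k : ℝ≥0∞) * R ^ k)) ≤
      ENNReal.ofReal ((16 * z * r) ^ k / (Nat.factorial k)) := fun k => by
    rw [hRr, ← ENNReal.ofReal_pow hr0, ← ENNReal.ofReal_natCast, ← ENNReal.ofReal_pow (Nat.cast_nonneg k),
      ← ENNReal.ofReal_mul (Nat.cast_nonneg k), ← ENNReal.ofReal_mul (by positivity),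
      ← ENNReal.ofReal_mul (by positivity)]
    refine ENNReal.ofReal_le_ofReal ?_
    have hk : (k : ℝ) ≤ 2 ^ k := by exact_mod_cast Nat.lt_two_pow_self.le
    have hk4 : (k : ℝ) ^ 3 * k ≤ 16 ^ k := by
      calc (k : ℝ) ^ 3 * k = (k : ℝ) ^ 4 := by ring
        _ ≤ (2 ^ k) ^ 4 := pow_le_pow_left₀ (Nat.cast_nonneg k) hk 4
        _ = 16 ^ k := by rw [← pow_mul, mul_comm, pow_mul]; norm_num
    rw [div_mul_eq_mul_div, mul_pow, mul_pow]
    refine div_le_div_of_nonneg_right ?_ (by positivity)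
    calc z ^ k * (k ^ 3 * (k * r ^ k)) = (k ^ 3 * k) * (z ^ k * r ^ k) := by ring
      _ ≤ 16 ^ k * (z ^ k * r ^ k) := by gcongr
      _ = 16 ^ k * z ^ k * r ^ k := by ring
  refine lt_of_le_of_lt (ENNReal.tsum_le_tsum hle) ?_
  rw [← ENNReal.ofReal_tsum_of_nonneg (fun k => by positivity) (Real.summable_pow_div_factorial _)]
  exact ENNReal.ofReal_lt_top

/-- **The specification bound for fourth moments, uniform in the boundary condition**: for measurable `f` with
`|f(q, v)| ≤ C (1 + ‖v‖)ⁿ` vanishing off the measurable window `Λ`, and every boundary condition `Y`,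
`∫ A_f⁴ dγ_Λ(·|Y) ≤ C⁴ Σₖ (zᵏ/k!) k⁴ Rᵏ`, `R = m(univ) + ∫ (1 + ‖v‖)^{4n} dm`, `m = maxwellPhaseMeasure β u Λ`. [folklore] -/
theorem lintegral_pow_four_linStat_gibbsSpecMeasure_le (ε z β : ℝ) (u : V3) (hΛ : MeasurableSet Λ)
    {f : V3 × V3 → ℝ} (hfm : Measurable f) {C : ℝ} {n : ℕ}
    (hf : ∀ p : V3 × V3, |f p| ≤ C * (1 + ‖p.2‖) ^ n) (hfΛ : ∀ p : V3 × V3, p.1 ∉ Λ → f p = 0) (Y : MarkedConfig) :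
    ∫⁻ X, ENNReal.ofReal (linStat f X ^ 4) ∂(gibbsSpecMeasure ε z β u Λ Y) ≤
      ENNReal.ofReal (C ^ 4) * ∑' k : ℕ, ENNReal.ofReal (z ^ k / (Nat.factorial k)) * ((k : ℝ≥0∞) ^ 3 *
        ((k : ℝ≥0∞) * (maxwellPhaseMeasure β u Λ Set.univ +
          ∫⁻ p, ENNReal.ofReal ((1 + ‖p.2‖) ^ (4 * n)) ∂(maxwellPhaseMeasure β u Λ)) ^ k)) := by
  -- adapted from `lintegral_sq_linStat_gibbsSpecMeasure_le` (…StressStrongMixingGibbsMoments.lean)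
  haveI := sigmaFinite_maxwellPhaseMeasure β u Λ
  set m : Measure (V3 × V3) := maxwellPhaseMeasure β u Λ with hm
  have hF : Measurable fun X : MarkedConfig => ENNReal.ofReal (linStat f X ^ 4) :=
    ((measurable_linStat hfm).pow_const 4).ennreal_ofReal
  rw [lintegral_gibbsSpecMeasure]
  calc (gibbsWeight ε z β u Λ Y Set.univ)⁻¹ *
        ∫⁻ X, ENNReal.ofReal (linStat f X ^ 4) ∂(gibbsWeightMeasure ε z β u Λ Y)
      ≤ 1 * ∫⁻ X, ENNReal.ofReal (linStat f X ^ 4) ∂(gibbsWeightMeasure ε z β u Λ Y) :=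
        mul_le_mul' (ENNReal.inv_le_one.2 (one_le_gibbsWeight_univ ε z β u Λ Y)) le_rfl
    _ = ∑' k : ℕ, ENNReal.ofReal (z ^ k / (Nat.factorial k)) *
          ∫⁻ x in {x | HardCoreIn ε Λ (superposeIn Λ x Y)}, ENNReal.ofReal (linStat f (superposeIn Λ x Y) ^ 4)
            ∂(Measure.pi fun _ : Fin k => m) := by
        rw [one_mul, lintegral_gibbsWeightMeasure ε z β u hΛ Y hF]
    _ ≤ ∑' k : ℕ, ENNReal.ofReal (z ^ k / (Nat.factorial k)) * (ENNReal.ofReal (C ^ 4) * ((k : ℝ≥0∞) ^ 3 *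
          ((k : ℝ≥0∞) * (m Set.univ + ∫⁻ p, ENNReal.ofReal ((1 + ‖p.2‖) ^ (4 * n)) ∂m) ^ k))) :=
        ENNReal.tsum_le_tsum fun k =>
          mul_le_mul' le_rfl (setLIntegral_pi_pow_four_linStat_superposeIn_le hf hfΛ m k Y _)
    _ = _ := by
        rw [← ENNReal.tsum_mul_left]
        refine tsum_congr fun k => ?_
        ring

/-- **Fourth moments of local linear statistics under a hard-sphere Gibbs state** (activity `z ≥ 0`, inverse
temperature `θ⁻¹`, any drift, any diameter): for measurable `f` with `|f(q, v)| ≤ C (1 + ‖v‖)ⁿ` vanishing off a bounded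
measurable window, `∫ A_f⁴ dμ < ∞` — the DLR equation for functions and the uniform specification bound. [folklore] -/
theorem lintegral_pow_four_linStat_lt_top_of_isHardSphereGibbs {σ z θ : ℝ} (hz : 0 ≤ z) (hθ : 0 < θ) {u : V3}
    {μ : Measure MarkedConfig} (hμ : IsHardSphereGibbs σ z θ⁻¹ u μ)
    (hΛ : MeasurableSet Λ) (hΛb : Bornology.IsBounded Λ)
    {f : V3 × V3 → ℝ} (hfm : Measurable f) {C : ℝ} {n : ℕ}
    (hf : ∀ p : V3 × V3, |f p| ≤ C * (1 + ‖p.2‖) ^ n) (hfΛ : ∀ p : V3 × V3, p.1 ∉ Λ → f p = 0) :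
    ∫⁻ ω, ENNReal.ofReal (linStat f ω ^ 4) ∂μ < ∞ := by
  -- adapted from `lintegral_sq_linStat_lt_top_of_isHardSphereGibbs` (…StressStrongMixingGibbsMoments.lean)
  haveI := hμ.1
  have hF : Measurable fun X : MarkedConfig => ENNReal.ofReal (linStat f X ^ 4) :=
    ((measurable_linStat hfm).pow_const 4).ennreal_ofReal
  set R : ℝ≥0∞ := maxwellPhaseMeasure θ⁻¹ u Λ Set.univ +
    ∫⁻ p, ENNReal.ofReal ((1 + ‖p.2‖) ^ (4 * n)) ∂(maxwellPhaseMeasure θ⁻¹ u Λ) with hR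
  set B : ℝ≥0∞ := ENNReal.ofReal (C ^ 4) *
    ∑' k : ℕ, ENNReal.ofReal (z ^ k / (Nat.factorial k)) * ((k : ℝ≥0∞) ^ 3 * ((k : ℝ≥0∞) * R ^ k)) with hB
  have hRtop : R ≠ ∞ := maxwellPhaseMeasure_univ_add_lintegral_ne_top hθ u hΛb (4 * n)
  have hBtop : B < ∞ :=
    ENNReal.mul_lt_top ENNReal.ofReal_lt_top (tsum_ofReal_pow_div_factorial_mul_pow_four_lt_top hz hRtop)
  rw [lintegral_eq_lintegral_gibbsSpecMeasure hμ hΛ hΛb hF.aemeasurable]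
  calc ∫⁻ Y, ∫⁻ X, ENNReal.ofReal (linStat f X ^ 4) ∂(gibbsSpecMeasure σ z θ⁻¹ u Λ Y) ∂μ
      ≤ ∫⁻ _, B ∂μ := lintegral_mono fun Y => lintegral_pow_four_linStat_gibbsSpecMeasure_le σ z θ⁻¹ u hΛ hfm hf hfΛ Y
    _ = B := by rw [lintegral_const, measure_univ, mul_one]
    _ < ∞ := hBtop

/-- **The fourth power of a local linear statistic of polynomial velocity growth is integrable under every hard-sphere
Gibbs state** (`z ≥ 0`, `θ > 0`, any drift, any diameter, any bounded measurable window). [folklore] -/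
theorem integrable_pow_four_linStat_of_isHardSphereGibbs {σ z θ : ℝ} (hz : 0 ≤ z) (hθ : 0 < θ) {u : V3}
    {μ : Measure MarkedConfig} (hμ : IsHardSphereGibbs σ z θ⁻¹ u μ)
    (hΛ : MeasurableSet Λ) (hΛb : Bornology.IsBounded Λ)
    {f : V3 × V3 → ℝ} (hfm : Measurable f) {C : ℝ} {n : ℕ}
    (hf : ∀ p : V3 × V3, |f p| ≤ C * (1 + ‖p.2‖) ^ n) (hfΛ : ∀ p : V3 × V3, p.1 ∉ Λ → f p = 0) :
    Integrable (fun ω => linStat f ω ^ 4) μ := by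
  refine ⟨((measurable_linStat hfm).pow_const 4).aestronglyMeasurable, ?_⟩
  rw [hasFiniteIntegral_iff_ofReal (ae_of_all _ fun ω => Even.pow_nonneg (by decide : Even 4) (linStat f ω))]
  exact lintegral_pow_four_linStat_lt_top_of_isHardSphereGibbs hz hθ hμ hΛ hΛb hfm hf hfΛ

/-- **One-body cell observables of polynomial velocity growth have finite fourth moments under every hard-sphere Gibbs
state**: `A_h⁴ ∈ L¹(μ)` for `A_h = cellObs h`, `h` measurable with `|h(v)| ≤ C (1 + ‖v‖)ⁿ`. [folklore] -/
theorem integrable_pow_four_cellObs_of_isHardSphereGibbs {σ z θ : ℝ} (hz : 0 ≤ z) (hθ : 0 < θ) {u : V3}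
    {μ : Measure MarkedConfig} (hμ : IsHardSphereGibbs σ z θ⁻¹ u μ) {h : V3 → ℝ} (hm : Measurable h)
    {C : ℝ} {n : ℕ} (hh : ∀ v, |h v| ≤ C * (1 + ‖v‖) ^ n) : Integrable (fun ω => cellObs h ω ^ 4) μ := by
  -- adapted from `memLp_two_cellObs_of_isHardSphereGibbs` (…StressStrongMixingGibbsMoments.lean)
  have hC : 0 ≤ C := nonneg_of_abs_le_mul_one_add_norm_pow hh
  have e : (fun p : V3 × V3 => unitCell.indicator (fun _ => h p.2) p.1) =
      (Prod.fst ⁻¹' unitCell).indicator fun p => h p.2 := by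
    funext p
    by_cases hp : p.1 ∈ unitCell
    · simp [hp]
    · simp [hp]
  change Integrable (fun ω => (linStat fun p : V3 × V3 => unitCell.indicator (fun _ => h p.2) p.1) ω ^ 4) μ
  refine integrable_pow_four_linStat_of_isHardSphereGibbs hz hθ hμ measurableSet_unitCell isBounded_unitCell ?_
    (C := C) (n := n) (fun p => ?_) (fun p hp => ?_)
  · rw [e]
    exact (hm.comp measurable_snd).indicator (measurableSet_unitCell.preimage measurable_fst)
  · by_cases hp : p.1 ∈ unitCell
    · rw [Set.indicator_of_mem hp]
      exact hh p.2
    · rw [Set.indicator_of_notMem hp, abs_zero]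
      positivity
  · exact Set.indicator_of_notMem hp _

/-- **The six generators have finite fourth moments** under every Gibbs state of the hard-sphere gas of diameter `σ`,
activity `z > 0`, inverse temperature `θ⁻¹`, zero drift (one-body densities of at most quadratic velocity growth).
[folklore] -/
theorem integrable_pow_four_of_mem_generators {σ θ z : ℝ} (hθ : 0 < θ) (hz : 0 < z) {μ : Measure MarkedConfig}
    (hμ : IsHardSphereGibbs σ z θ⁻¹ (0 : V3) μ) {a : MarkedConfig → ℝ}
    (ha : a ∈ Set.range cellCharge ∪ {cellObs fun v : V3 => v 0 * v 1}) : Integrable (fun ω => a ω ^ 4) μ := by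
  rcases ha with ⟨i, rfl⟩ | ha
  · exact integrable_pow_four_cellObs_of_isHardSphereGibbs hz.le hθ hμ (continuous_chargeFn i).measurable (C := 1)
      (n := 2) fun v => by simpa only [one_mul] using abs_chargeFn_le i v
  · rw [Set.mem_singleton_iff.1 ha]
    exact integrable_pow_four_cellObs_of_isHardSphereGibbs hz.le hθ hμ
      (show Continuous fun v : V3 => v 0 * v 1 by fun_prop).measurable abs_shearStress_le

/-- **Registered helper stub (part 2 of `stub_staticClustering`)**: the six generators have finite fourth moments under
every hard-sphere Gibbs state (`integrable_pow_four_of_mem_generators` in closed form). [folklore] -/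
theorem staticClustering_generatorFourthMoments : ∀ (σ θ z : ℝ), 0 < θ → 0 < z → ∀ μ : Measure MarkedConfig, IsHardSphereGibbs σ z θ⁻¹ (0 : V3) μ → ∀ a ∈ Set.range cellCharge ∪ {cellObs fun v : V3 => v 0 * v 1}, Integrable (fun ω => a ω ^ 4) μ :=
  fun _σ _θ _z hθ hz _μ hμ _a ha => integrable_pow_four_of_mem_generators hθ hz hμ ha

end Gibbs

end Summit.AtomisticToContinuum.HydrodynamicLimit.Theorems.MourreKoopmanChargesStressStrongMixing

end
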